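/-
Copyright (c) 2026 the pub-hodgecm-mathlib formalisation cell (harness21).  Prover seat hodgecm-mathlib-K2E1-p16 (g2), Track B «K2-LIT» ENGINE E1, h413 = `stmt-HodgeConjecture-24833`,
route `HCCMUnconditional`, R90-S8 «ContSpec-n½» #4′ letter chain, deal H8 (IDENT) (S8 dealer R90-CS-plan (g2), S8-R38 (2) ∕ HEAD OF RECORD S8-R41): THE PURE-ATOM VECTORS OF A
SELF-DUAL BLOCK ARE SPANNED BY ITS RESIDUE CLASSES — K2E2-p12's model letter (M) `hatom` of ★ `R90S8ResHResiduesAreCharLinesU2`, paid from the SD Plancherel package.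
-/
import Summits.HodgeConjecture.HodgeConjecture.Theorems.K2E1PlancherelModelMapOfIsometry   -- ★ (K2E4-p23) `completeSpace_topologicalClosure_span`; brings ★ P3a `mem_topologicalClosure_span` (the `Θ = closure span` spelling of §3)
import Mathlib.Analysis.MellinTransform
import HarnessLib

/-!
# h413 ∕ R90-S8 #4′ chain, H8 (IDENT) — `R90S8BlockAtomsAreResiduesU2`: THE PURE-ATOM VECTORS OF A SELF-DUAL BLOCK ARE SPANNED BY ITS RESIDUE CLASSES

Cell `pub/hodgecm-mathlib`, crux H413 = `stmt-HodgeConjecture-24833`; S8 dealer R90-CS-plan (g2) S8-R38 (2), HEAD OF RECORD S8-R41; census `K2/K2E1-p16/g2/CENSUS-H8.md`.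
THEOREMS ONLY (no `def`, no `instance`, no `notation`, no named-fact hypothesis, no `sorry`; default heartbeats); lane `--kind proof --supports stmt-HodgeConjecture-24833 --as helper`
(count-neutral).  ABSTRACT HILBERT-SPACE FILE (Mathlib + ★ `K2E1PlancherelModelMapOfIsometry`): the block enters only through `(Sc : Submodule ℂ H)`, the model map
`U : H →ₗ[ℂ] A × Λ` and the residue family `e : ιa → H`, so at K2E1-p15's ★ `resHAtom L μ U K' ω χ := resHBlock L μ K' ω χ ⊓ LinearMap.ker ((LinearMap.snd ℂ A Λ).comp U)`
(`R90S8ResHBlockDataU2Defs`, R1 of record) every head applies by `rfl`, and the conclusion is K2E2-p12's (M) letter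
**`hatom : ∀ v ∈ Sc, (U v).2 = 0 → v ∈ Submodule.span ℂ (Set.range e)`** (★ `R90S8ResHResiduesAreCharLinesU2` §1) VERBATIM.

THE MATHEMATICS ([MoeglinWaldspurger1995, IV.1.11, V.3.13, VI.2]; [Langlands1976, §7, Lemmas 7.5–7.6]).  In the self-dual block `Sc = closure span {[θ_Ψ]}` with its Plancherel isometry
`Uiso : Sc ≅ (⊕_{c∈S} V) ⊕₂ L²((0,∞); V)` (★ `K2E1ChiSectionPlancherelSelfDualOfLetters.exists_linearIsometry_selfDual_of_letters`: `Uiso [θ_{Ψ_i}] = (r_i, √(C∕2π)·w_i)`, atom Gram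
`⟪r_i, r_j⟫ = C·Σ_c ⟪Ψ̂_i(−c), R_c Ψ̂_j(−c)⟫`), the PURE-ATOM vectors `At := Sc ⊓ ker (snd ∘ U)` (`U = Uiso ∘ P_Θ`, ★ `K2E1PlancherelModelMapOfIsometry`) are the residual part of the
block, and the residue classes `e (c, a) = [Res_{z=c} E(φ_a, z)]` span it.  KEY POINT of the census: the atom vectors `r_i` are ABSTRACT in the ★ package (★ `exists_gram_of_nonneg_finset`
prints only their Gram), so the identification cannot be done «by coordinates» (`U(Res) = (e_c ⊗ ·, 0)` is not statable); it goes through the PAIRINGS with the dense generators.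
Three facts about the residue classes are needed and suffice:
* (E1) `e (c,a) ∈ Sc` — block membership (exhaustion ∕ range-splitting class — a visible LETTER `he` here; paid from `hpair` + the residue NORM letter via Mellin interpolation in the sequel);
* (E2) `(U (e (c,a))).2 = 0` — no line mass (D5′ class — a visible LETTER `hU0` here);
* (E3) COMPLETENESS — a pure-atom vector orthogonal to every residue class vanishes.  §2 PROVES (E3) from the package letters (`hU` generator model vectors, `hrG` atom Gram, `hRsymm`)
  and ONE PAIRING LETTER `hpair : ⟪x i, e (c,a)⟫ = C·⟪Ψ̂_i(−c), R_c φ_a⟫` («⟨θ_Ψ, Res_c E(φ_a)⟩ = C·⟨Ψ̂(−c), R_c φ_a⟩», [MoeglinWaldspurger1995, IV.1.11]): the functional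
  `Λ_j v := ⟪r_j, (U v).1⟫ − Σ_c Σ_a conj(Ψ̂_{j,a}(−c))·⟪e (c,a), v⟫` is continuous linear and VANISHES ON THE GENERATORS (`hrG` ∘ `hRsymm` ∘ `hpair`), hence on `Sc`
  (`ContinuousLinearMap.eqOn_closure_span`); so `v ⟂ every e (c,a)` forces `(U v).1 ⟂ every r_j` while `(U v).1 ∈ closure span {r_j} = span {r_j}` (finite-dimensional), i.e.
  `(U v).1 = 0`; with `(U v).2 = 0` and injectivity of `Uiso`, `v = 0`.  No positivity, no square roots, no explicit atom coordinates.
* §1 THEOREM A `mem_span_of_atoms_complete` — (E1)+(E2)+(E3) ⇒ `hatom` (generic `Sc`, `U`, finite residue family; `u := v − P_{span e} v ∈ At ∩ (span e)ᗮ`).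
* §2 THEOREM B `fst_modelMap_mem_span`, `fst_eq_zero_of_forall_inner_residue_eq_zero`, `eq_zero_of_snd_eq_zero_of_forall_inner_residue_eq_zero` — (E3) from the SD package + `hpair`.
* §3 HEAD **`blockAtoms_subset_span_residues_of_letters`** — `hatom` for a sub-block `Sc ≤ Θ` (★ D5′ block-domain letter `hBD`; `Sc := Θ` allowed) of a complete block `Θ` with
  dense generators (`Θ := resHBlock …` with `x` the inclusion of its generating set, or `Θ := closure span {x_i}`), at the ★ D5′ plain-product model map
  `(WithLp.linearEquiv 2 ℂ _) ∘ₗ (Uiso.toContinuousLinearMap ∘L Θ.orthogonalProjectionOnto)` (= K2E1-p15's MODEL-FAMILY `U := equiv ∘ Uiso ∘ P_{Sc}`), modulo the visible letters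
  (E1) `he`, (E2) `hU0`, `hpair`; + the `∘ₗ Sc.starProjection` edition `…_proj` (`U_b = U ∘ P_{Sc}` when `Θ ⊋ Sc`) and the `Θ = closure span {x_i}` spelling `…_closureSpan`
  (★ `exists_linearIsometry_selfDual_of_letters` ∕ ★ `K2E1PlancherelModelMapOfIsometry` domain).
HONEST LABEL: HC_CM is proved only modulo the 7 printed citations (2 remaining named inputs: hLiu418 = `stmt-HodgeConjecture-24832`, h413 = `stmt-HodgeConjecture-24833`) until rung 0
closes; this file asserts no named fact, is conditional by construction on its visible binders ((E1), (E2), `hpair`, the SD package letters), and closes no socket; count-neutral.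

## References
* [MoeglinWaldspurger1995] C. Mœglin, J.-L. Waldspurger, *Spectral Decomposition and Eisenstein Series* (1995), IV.1.11, V.3.13, VI.2.
* [Langlands1976] R. P. Langlands, *On the Functional Equations Satisfied by Eisenstein Series*, LNM 544 (1976), §7.
* [ReedSimonI1980] M. Reed, B. Simon, *Methods of Modern Mathematical Physics I* (1980), Thm. II.3 (projection theorem), Thm. I.7.
-/

set_option autoImplicit false
-- the mandated namespace `…HodgeConjecture.HodgeConjecture.R90.S8` (LEAD #1 L1) repeats the summit's segment
set_option linter.dupNamespace false

noncomputable section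

open Complex
open scoped InnerProductSpace ComplexConjugate BigOperators
open Summit.HodgeConjecture.HodgeConjecture.Cruxes.H413.K2E1PlancherelIsometryOfForm (mem_topologicalClosure_span)
open Summit.HodgeConjecture.HodgeConjecture.Cruxes.H413.K2E1PlancherelModelMapOfIsometry (completeSpace_topologicalClosure_span)

namespace Summit.HodgeConjecture.HodgeConjecture.R90.S8

/-! ## §1 THEOREM A — a finite residue family inside the atoms which is COMPLETE for the atoms spans them -/

section Complete

variable {H : Type*} [NormedAddCommGroup H] [InnerProductSpace ℂ H] {A Λ : Type*} [AddCommGroup A] [Module ℂ A] [AddCommGroup Λ] [Module ℂ Λ]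

/-- **THEOREM A — COMPLETE RESIDUE FAMILIES SPAN THE ATOMS.**  `Sc` a block, `U : H →ₗ A × Λ` its model map, `e : ιa → H` a FINITE family with (E1) `e j ∈ Sc`, (E2) `(U (e j)).2 = 0`,
and (E3) COMPLETE for the pure-atom vectors: `v ∈ Sc`, `(U v).2 = 0`, `⟪e j, v⟫ = 0` for all `j` ⇒ `v = 0`.  THEN every pure-atom vector of `Sc` lies in `span {e j}` — K2E2-p12's
letter `hatom` verbatim.  Proof: `u := v − P_{span e} v` is again a pure-atom vector (the span is finite-dimensional, hence complete, inside `Sc ⊓ ker (snd ∘ U)`), and `u ⟂ span e`;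
(E3) kills it. [cite: MoeglinWaldspurger1995, V.3.13] [cite: ReedSimonI1980, Thm. II.3] -/
theorem mem_span_of_atoms_complete (Sc : Submodule ℂ H) (U : H →ₗ[ℂ] A × Λ) {ιa : Type*} [Finite ιa] (e : ιa → H)
    (he : ∀ j, e j ∈ Sc) (hU0 : ∀ j, (U (e j)).2 = 0)
    (hcomplete : ∀ v ∈ Sc, (U v).2 = 0 → (∀ j, ⟪e j, v⟫_ℂ = 0) → v = 0) :
    ∀ v ∈ Sc, (U v).2 = 0 → v ∈ Submodule.span ℂ (Set.range e) := by
  intro v hv hv0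
  haveI : FiniteDimensional ℂ (Submodule.span ℂ (Set.range e)) := FiniteDimensional.span_of_finite ℂ (Set.finite_range e)
  haveI : CompleteSpace (Submodule.span ℂ (Set.range e)) := FiniteDimensional.complete ℂ _
  -- the span sits inside the block and inside `ker (snd ∘ U)`
  have hSSc : Submodule.span ℂ (Set.range e) ≤ Sc := Submodule.span_le.2 (Set.range_subset_iff.2 he)
  have hSker : Submodule.span ℂ (Set.range e) ≤ LinearMap.ker ((LinearMap.snd ℂ A Λ).comp U) :=
    Submodule.span_le.2 (Set.range_subset_iff.2 fun j => by
      change ((LinearMap.snd ℂ A Λ).comp U) (e j) = 0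
      rw [LinearMap.comp_apply, LinearMap.snd_apply, hU0 j])
  -- the defect `u := v − P v`
  have huS : v - (Submodule.span ℂ (Set.range e)).starProjection v ∈ (Submodule.span ℂ (Set.range e))ᗮ := Submodule.sub_starProjection_mem_orthogonal v
  have hPv : (Submodule.span ℂ (Set.range e)).starProjection v ∈ Submodule.span ℂ (Set.range e) := Submodule.starProjection_apply_mem _ v
  have huSc : v - (Submodule.span ℂ (Set.range e)).starProjection v ∈ Sc := Sc.sub_mem hv (hSSc hPv)
  have hu0 : (U (v - (Submodule.span ℂ (Set.range e)).starProjection v)).2 = 0 := by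
    have hP0 : (U ((Submodule.span ℂ (Set.range e)).starProjection v)).2 = 0 := by
      have := hSker hPv
      rw [LinearMap.mem_ker, LinearMap.comp_apply, LinearMap.snd_apply] at this
      exact this
    rw [map_sub, Prod.snd_sub, hv0, hP0, sub_zero]
  have hperp : ∀ j, ⟪e j, v - (Submodule.span ℂ (Set.range e)).starProjection v⟫_ℂ = 0 := fun j =>
    Submodule.inner_right_of_mem_orthogonal (Submodule.subset_span (Set.mem_range_self j)) huS
  have hu := hcomplete _ huSc hu0 hperp
  rw [sub_eq_zero] at hu
  rw [hu]
  exact hPv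

end Complete

/-! ## §2 THEOREM B — completeness (E3) from the self-dual package letters and the pairing letter -/

section Pairing

variable {V : Type*} [NormedAddCommGroup V] [InnerProductSpace ℂ V] [FiniteDimensional ℂ V]
  {H : Type*} [NormedAddCommGroup H] [InnerProductSpace ℂ H]
  {M₂ : Type*} [NormedAddCommGroup M₂] [InnerProductSpace ℂ M₂]
  {ι α : Type*} [Fintype α]

/-- **THE ATOM COORDINATE OF A BLOCK VECTOR LIES IN THE SPAN OF THE GENERATORS' ATOM VECTORS**: `Θ` a complete block in which the generators `x_i ∈ Θ` are dense
(`hΘ : Θ ⊆ closure span {x_i}`), `Uiso : Θ →ₗᵢ (⊕_c V) ⊕₂ M₂` with `Uiso x_i = (r_i, w_i)`; then for `v ∈ Θ`, `(Uiso v).1 ∈ span {r_i}` — the model map `U = Uiso ∘ P_Θ` is continuous and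
`span {r_i}` is finite-dimensional, hence closed. [cite: ReedSimonI1980, Thm. I.7] -/
theorem fst_modelMap_mem_span {S : Finset ℝ} (Θ : Submodule ℂ H) [Θ.HasOrthogonalProjection] (x : ι → H) (hxΘ : ∀ i, x i ∈ Θ)
    (hΘ : (Θ : Set H) ⊆ closure (Submodule.span ℂ (Set.range x) : Set H))
    (r : ι → PiLp 2 (fun _ : ↥S => V)) (w : ι → M₂) (Uiso : ↥Θ →ₗᵢ[ℂ] WithLp 2 (PiLp 2 (fun _ : ↥S => V) × M₂))
    (hU : ∀ i, Uiso ⟨x i, hxΘ i⟩ = WithLp.toLp 2 (r i, w i)) (v : ↥Θ) :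
    (Uiso v).fst ∈ Submodule.span ℂ (Set.range r) := by
  haveI : FiniteDimensional ℂ (Submodule.span ℂ (Set.range r)) := FiniteDimensional.finiteDimensional_submodule _
  -- the continuous linear map `v ↦ (U v).1` on all of `H`
  set F : H →L[ℂ] PiLp 2 (fun _ : ↥S => V) := (WithLp.fstL 2 ℂ (PiLp 2 (fun _ : ↥S => V)) M₂).comp (Uiso.toContinuousLinearMap.comp Θ.orthogonalProjectionOnto) with hF
  have hFΘ : ∀ u : ↥Θ, F (u : H) = (Uiso u).fst := fun u => by
    rw [hF, ContinuousLinearMap.comp_apply, ContinuousLinearMap.comp_apply, Submodule.orthogonalProjectionOnto_mem_subspace_eq_self]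
    rfl
  -- the closed submodule `F⁻¹(span r)` contains the generators, hence the closed span, hence `Θ`
  have hle : Submodule.span ℂ (Set.range x) ≤ (Submodule.span ℂ (Set.range r)).comap F.toLinearMap :=
    Submodule.span_le.2 (Set.range_subset_iff.2 fun i => by
      change F (x i) ∈ Submodule.span ℂ (Set.range r)
      rw [hFΘ ⟨x i, hxΘ i⟩, hU i, WithLp.toLp_fst]
      exact Submodule.subset_span ⟨i, rfl⟩)
  have hclosed : IsClosed (((Submodule.span ℂ (Set.range r)).comap F.toLinearMap : Submodule ℂ H) : Set H) := by
    rw [Submodule.comap_coe, ContinuousLinearMap.coe_coe]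
    exact (Submodule.span ℂ (Set.range r)).closed_of_finiteDimensional.preimage F.continuous
  have hvcl : (v : H) ∈ (Submodule.span ℂ (Set.range x)).topologicalClosure := by
    rw [← SetLike.mem_coe, Submodule.topologicalClosure_coe]
    exact hΘ v.2
  have hmem : (v : H) ∈ (Submodule.span ℂ (Set.range r)).comap F.toLinearMap := (Submodule.topologicalClosure_minimal _ hle hclosed) hvcl
  rw [Submodule.mem_comap] at hmem
  change F (v : H) ∈ Submodule.span ℂ (Set.range r) at hmem
  rwa [hFΘ v] at hmem

/-- **THE ATOM COORDINATE OF A BLOCK VECTOR ORTHOGONAL TO EVERY RESIDUE CLASS VANISHES.**  Self-dual package letters on a complete block `Θ` with dense generators `x_i`: generator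
model vectors `hU : Uiso x_i = (r_i, w_i)`, atom Gram `hrG : ⟪r_i, r_j⟫ = C·Σ_{c∈S} ⟪Ψ̂_i(−c), R_c Ψ̂_j(−c)⟫` (`Ψ̂_i(−c) = Σ_a mellin (f i a) (−c) • φ_a`), `hRsymm`; residue family
`e : S × α → H` with the PAIRING LETTER `hpair : ⟪x_i, e (c,a)⟫ = C·⟪Ψ̂_i(−c), R_c φ_a⟫`.  Then for `v ∈ Θ` with `⟪e (c,a), v⟫ = 0` for all `(c,a)`: `(Uiso v).1 = 0`.  Proof: the
continuous linear functional `Λ_j v := ⟪r_j, (U v).1⟫ − Σ_c Σ_a conj(mellin (f j a)(−c))·⟪e (c,a), v⟫` vanishes on the generators (`hrG`, `hRsymm`, `hpair`), hence on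
`closure span {x_i} ⊇ Θ` (`eqOn_closure_span`); so `(U v).1 ⟂ r_j` for every `j`, while `(U v).1 ∈ span {r_j}` (`fst_modelMap_mem_span`).
[cite: MoeglinWaldspurger1995, IV.1.11, V.3.13] [cite: Langlands1976, §7] -/
theorem fst_eq_zero_of_forall_inner_residue_eq_zero
    (f : ι → α → ℝ → ℂ) (φ : α → V) (S : Finset ℝ) (R : ℝ → V →ₗ[ℂ] V) (hRsymm : ∀ c ∈ S, ∀ v v' : V, ⟪v, R c v'⟫_ℂ = ⟪R c v, v'⟫_ℂ)
    (Θ : Submodule ℂ H) [Θ.HasOrthogonalProjection] (x : ι → H) (hxΘ : ∀ i, x i ∈ Θ) (hΘ : (Θ : Set H) ⊆ closure (Submodule.span ℂ (Set.range x) : Set H))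
    (C : ℝ) (r : ι → PiLp 2 (fun _ : ↥S => V)) (w : ι → M₂) (Uiso : ↥Θ →ₗᵢ[ℂ] WithLp 2 (PiLp 2 (fun _ : ↥S => V) × M₂))
    (hU : ∀ i, Uiso ⟨x i, hxΘ i⟩ = WithLp.toLp 2 (r i, w i))
    (hrG : ∀ i j, ⟪r i, r j⟫_ℂ = (C : ℂ) * ∑ c ∈ S, ⟪∑ b, mellin (f i b) (-(c : ℂ)) • φ b, R c (∑ a, mellin (f j a) (-(c : ℂ)) • φ a)⟫_ℂ)
    (e : ↥S × α → H)
    (hpair : ∀ (i : ι) (c : ↥S) (a : α), ⟪x i, e (c, a)⟫_ℂ = (C : ℂ) * ⟪∑ b, mellin (f i b) (-((c : ℝ) : ℂ)) • φ b, R c (φ a)⟫_ℂ)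
    (v : ↥Θ) (hperp : ∀ (c : ↥S) (a : α), ⟪e (c, a), (v : H)⟫_ℂ = 0) :
    (Uiso v).fst = 0 := by
  -- the model map on `H` and its atom coordinate
  set F : H →L[ℂ] PiLp 2 (fun _ : ↥S => V) := (WithLp.fstL 2 ℂ (PiLp 2 (fun _ : ↥S => V)) M₂).comp (Uiso.toContinuousLinearMap.comp Θ.orthogonalProjectionOnto) with hF
  have hFΘ : ∀ u : ↥Θ, F (u : H) = (Uiso u).fst := fun u => by
    rw [hF, ContinuousLinearMap.comp_apply, ContinuousLinearMap.comp_apply, Submodule.orthogonalProjectionOnto_mem_subspace_eq_self]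
    rfl
  have hFx : ∀ i, F (x i) = r i := fun i => by rw [hFΘ ⟨x i, hxΘ i⟩, hU i, WithLp.toLp_fst]
  -- STEP 1: for every `j`, `⟪r j, (Uiso v).1⟫ = 0`, by the functional `Λ_j`
  have horth : ∀ j, ⟪r j, (Uiso v).fst⟫_ℂ = 0 := by
    intro j
    -- the two continuous linear functionals
    set L₁ : H →L[ℂ] ℂ := (innerSL ℂ (r j)).comp F with hL₁
    set L₂ : H →L[ℂ] ℂ := ∑ c : ↥S, ∑ a : α, (conj (mellin (f j a) (-((c : ℝ) : ℂ)))) • innerSL ℂ (e (c, a)) with hL₂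
    have hL₂_apply : ∀ u : H, L₂ u = ∑ c : ↥S, ∑ a : α, conj (mellin (f j a) (-((c : ℝ) : ℂ))) * ⟪e (c, a), u⟫_ℂ := fun u => by
      simp only [hL₂, _root_.sum_apply, _root_.smul_apply, innerSL_apply_apply, smul_eq_mul]
    -- they agree on the generators
    have hgen : Set.EqOn L₁ L₂ (Set.range x) := by
      rintro _ ⟨i, rfl⟩
      rw [hL₂_apply, hL₁, ContinuousLinearMap.comp_apply, innerSL_apply_apply, hFx i, hrG j i, ← Finset.sum_coe_sort S, Finset.mul_sum]
      refine Finset.sum_congr rfl fun c _ => ?_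
      -- `C·⟪Ψ_j c, R c (Ψ_i c)⟫ = Σ_a conj(m_{j a c}) · ⟪e (c,a), x i⟫`
      have hea : ∀ a : α, ⟪e (c, a), x i⟫_ℂ = (C : ℂ) * ⟪R c (φ a), ∑ b, mellin (f i b) (-((c : ℝ) : ℂ)) • φ b⟫_ℂ := fun a => by
        rw [← inner_conj_symm, hpair i c a, map_mul, Complex.conj_ofReal, inner_conj_symm]
      simp_rw [hea]
      calc (C : ℂ) * ⟪∑ b, mellin (f j b) (-((c : ℝ) : ℂ)) • φ b, R c (∑ a, mellin (f i a) (-((c : ℝ) : ℂ)) • φ a)⟫_ℂ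
          = (C : ℂ) * ⟪R c (∑ b, mellin (f j b) (-((c : ℝ) : ℂ)) • φ b), ∑ a, mellin (f i a) (-((c : ℝ) : ℂ)) • φ a⟫_ℂ := by rw [hRsymm c c.2]
        _ = (C : ℂ) * ∑ b, conj (mellin (f j b) (-((c : ℝ) : ℂ))) * ⟪R c (φ b), ∑ a, mellin (f i a) (-((c : ℝ) : ℂ)) • φ a⟫_ℂ := by
            rw [map_sum, sum_inner]
            refine congrArg _ (Finset.sum_congr rfl fun b _ => ?_)
            rw [LinearMap.map_smul, inner_smul_left]
        _ = ∑ a, conj (mellin (f j a) (-((c : ℝ) : ℂ))) * ((C : ℂ) * ⟪R c (φ a), ∑ b, mellin (f i b) (-((c : ℝ) : ℂ)) • φ b⟫_ℂ) := by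
            rw [Finset.mul_sum]
            exact Finset.sum_congr rfl fun a _ => by ring
    -- hence on the closed span, which contains `Θ`
    have hcl : Set.EqOn L₁ L₂ (closure (Submodule.span ℂ (Set.range x) : Set H)) := ContinuousLinearMap.eqOn_closure_span hgen
    have key := hcl (hΘ v.2)
    rw [hL₁, ContinuousLinearMap.comp_apply, innerSL_apply_apply, hFΘ v, hL₂_apply] at key
    rw [key]
    exact Finset.sum_eq_zero fun c _ => Finset.sum_eq_zero fun a _ => by rw [hperp c a, mul_zero]
  -- STEP 2: `(Uiso v).1 ∈ span {r j}` and `⟂` every `r j` ⇒ `= 0`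
  have hmem : (Uiso v).fst ∈ Submodule.span ℂ (Set.range r) := fst_modelMap_mem_span Θ x hxΘ hΘ r w Uiso hU v
  have hself : ⟪(Uiso v).fst, (Uiso v).fst⟫_ℂ = 0 := by
    refine Submodule.span_induction (p := fun u _ => ⟪u, (Uiso v).fst⟫_ℂ = 0) ?_ ?_ ?_ ?_ hmem
    · rintro _ ⟨j, rfl⟩
      exact horth j
    · exact inner_zero_left _
    · intro u u' _ _ hu hu'
      rw [inner_add_left, hu, hu', add_zero]
    · intro t u _ hu
      rw [inner_smul_left, hu, mul_zero]
  exact inner_self_eq_zero.1 hself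

/-- **THEOREM B — COMPLETENESS (E3) OF THE RESIDUE FAMILY FOR THE PURE-ATOM VECTORS, from the self-dual package letters and the pairing letter**: a block vector `v ∈ Θ` with vanishing
LINE coordinate `(Uiso v).2 = 0` and `⟪e (c,a), v⟫ = 0` for every residue class is `0` — its atom coordinate vanishes (`fst_eq_zero_of_forall_inner_residue_eq_zero`), so `Uiso v = 0`,
and `Uiso` is isometric. [cite: MoeglinWaldspurger1995, IV.1.11, V.3.13] [cite: Langlands1976, §7] -/
theorem eq_zero_of_snd_eq_zero_of_forall_inner_residue_eq_zero
    (f : ι → α → ℝ → ℂ) (φ : α → V) (S : Finset ℝ) (R : ℝ → V →ₗ[ℂ] V) (hRsymm : ∀ c ∈ S, ∀ v v' : V, ⟪v, R c v'⟫_ℂ = ⟪R c v, v'⟫_ℂ)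
    (Θ : Submodule ℂ H) [Θ.HasOrthogonalProjection] (x : ι → H) (hxΘ : ∀ i, x i ∈ Θ) (hΘ : (Θ : Set H) ⊆ closure (Submodule.span ℂ (Set.range x) : Set H))
    (C : ℝ) (r : ι → PiLp 2 (fun _ : ↥S => V)) (w : ι → M₂) (Uiso : ↥Θ →ₗᵢ[ℂ] WithLp 2 (PiLp 2 (fun _ : ↥S => V) × M₂))
    (hU : ∀ i, Uiso ⟨x i, hxΘ i⟩ = WithLp.toLp 2 (r i, w i))
    (hrG : ∀ i j, ⟪r i, r j⟫_ℂ = (C : ℂ) * ∑ c ∈ S, ⟪∑ b, mellin (f i b) (-(c : ℂ)) • φ b, R c (∑ a, mellin (f j a) (-(c : ℂ)) • φ a)⟫_ℂ)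
    (e : ↥S × α → H)
    (hpair : ∀ (i : ι) (c : ↥S) (a : α), ⟪x i, e (c, a)⟫_ℂ = (C : ℂ) * ⟪∑ b, mellin (f i b) (-((c : ℝ) : ℂ)) • φ b, R c (φ a)⟫_ℂ)
    (v : ↥Θ) (hv2 : (Uiso v).snd = 0) (hperp : ∀ (c : ↥S) (a : α), ⟪e (c, a), (v : H)⟫_ℂ = 0) :
    v = 0 := by
  have h1 := fst_eq_zero_of_forall_inner_residue_eq_zero f φ S R hRsymm Θ x hxΘ hΘ C r w Uiso hU hrG e hpair v hperp
  have hU0 : Uiso v = 0 := by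
    have : Uiso v = WithLp.toLp 2 ((Uiso v).fst, (Uiso v).snd) := rfl
    rw [this, h1, hv2]
    rfl
  rw [← norm_eq_zero, ← Uiso.norm_map, hU0, norm_zero]

end Pairing

/-! ## §3 HEAD — H8 (IDENT): the pure-atom vectors of a self-dual block are spanned by its residue classes (modulo (E1), (E2), `hpair`) -/

section Head

variable {V : Type*} [NormedAddCommGroup V] [InnerProductSpace ℂ V] [FiniteDimensional ℂ V]
  {H : Type*} [NormedAddCommGroup H] [InnerProductSpace ℂ H]
  {M₂ : Type*} [NormedAddCommGroup M₂] [InnerProductSpace ℂ M₂]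
  {ι α : Type*} [Fintype α]

/-- **H8 (IDENT) — THE PURE-ATOM VECTORS OF A SELF-DUAL BLOCK ARE SPANNED BY ITS RESIDUE CLASSES, modulo the letters (E1) `he`, (E2) `hU0`, `hpair`.**  Data: a complete block
`Θ` carrying the self-dual Plancherel package of ★ `exists_linearIsometry_selfDual_of_letters` on dense generators `x : ι → H` (`hxΘ`, `hΘ`; `Uiso`, `hU`, atom Gram `hrG`, `hRsymm`; the axis
vectors `w i` absorb the scalar `√(C∕2π)`) — e.g. `Θ := closure span {x_i}` (★ `mem_topologicalClosure_span`, `hΘ` by `rfl`) or `Θ := resHBlock …` with `x` the inclusion of its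
generating set —, a sub-block `Sc ≤ Θ` (★ D5′ block-domain letter `hBD`; `Sc := Θ` allowed), the ★ D5′ plain-product model map `U := WithLp.linearEquiv ∘ₗ (Uiso ∘L P_Θ)` (★
`K2E1ResidualBlockPackageOfModelMap` ∕ K2E1-p15 MODEL-FAMILY currency), and the residue family `e : S × α → H` of the block at its weighted poles with (E1) block membership, (E2)
no line mass, and the pairing letter.  CONCLUSION = K2E2-p12's (M) letter `hatom` of ★ `R90S8ResHResiduesAreCharLinesU2` at `(Sc, U, e)`: `∀ v ∈ Sc, (U v).2 = 0 → v ∈ span (range e)`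
— so at K2E1-p15's `resHAtom L μ U K' ω χ` (R1) the pure-atom vectors are residue classes, and (L) follows from ★ (B) per atom.
[cite: MoeglinWaldspurger1995, IV.1.11, V.3.13, VI.2] [cite: Langlands1976, §7] -/
theorem blockAtoms_subset_span_residues_of_letters
    (f : ι → α → ℝ → ℂ) (φ : α → V) (S : Finset ℝ) (R : ℝ → V →ₗ[ℂ] V) (hRsymm : ∀ c ∈ S, ∀ v v' : V, ⟪v, R c v'⟫_ℂ = ⟪R c v, v'⟫_ℂ)
    (Θ : Submodule ℂ H) [Θ.HasOrthogonalProjection] (x : ι → H) (hxΘ : ∀ i, x i ∈ Θ) (hΘ : (Θ : Set H) ⊆ closure (Submodule.span ℂ (Set.range x) : Set H))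
    (C : ℝ) (r : ι → PiLp 2 (fun _ : ↥S => V)) (w : ι → M₂) (Uiso : ↥Θ →ₗᵢ[ℂ] WithLp 2 (PiLp 2 (fun _ : ↥S => V) × M₂))
    (hU : ∀ i, Uiso ⟨x i, hxΘ i⟩ = WithLp.toLp 2 (r i, w i))
    (hrG : ∀ i j, ⟪r i, r j⟫_ℂ = (C : ℂ) * ∑ c ∈ S, ⟪∑ b, mellin (f i b) (-(c : ℂ)) • φ b, R c (∑ a, mellin (f j a) (-(c : ℂ)) • φ a)⟫_ℂ)
    (Sc : Submodule ℂ H) (hBD : Sc ≤ Θ)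
    (e : ↥S × α → H) (he : ∀ p, e p ∈ Sc)
    (hU0 : ∀ p, (((WithLp.linearEquiv 2 ℂ (PiLp 2 (fun _ : ↥S => V) × M₂)).toLinearMap ∘ₗ (Uiso.toContinuousLinearMap.comp Θ.orthogonalProjectionOnto).toLinearMap) (e p)).2 = 0)
    (hpair : ∀ (i : ι) (c : ↥S) (a : α), ⟪x i, e (c, a)⟫_ℂ = (C : ℂ) * ⟪∑ b, mellin (f i b) (-((c : ℝ) : ℂ)) • φ b, R c (φ a)⟫_ℂ) :
    ∀ v ∈ Sc, (((WithLp.linearEquiv 2 ℂ (PiLp 2 (fun _ : ↥S => V) × M₂)).toLinearMap ∘ₗ (Uiso.toContinuousLinearMap.comp Θ.orthogonalProjectionOnto).toLinearMap) v).2 = 0 →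
      v ∈ Submodule.span ℂ (Set.range e) := by
  refine mem_span_of_atoms_complete Sc _ e he hU0 fun v hv hv0 hperp => ?_
  -- `v ∈ Sc ≤ Θ`; its line coordinate vanishes; it is orthogonal to every residue class ⇒ `v = 0` (THEOREM B)
  have hvΘ : v ∈ Θ := hBD hv
  have hv2 : (Uiso ⟨v, hvΘ⟩).snd = 0 := by
    have hP : Θ.orthogonalProjectionOnto v = ⟨v, hvΘ⟩ := Submodule.orthogonalProjectionOnto_mem_subspace_eq_self (⟨v, hvΘ⟩ : ↥Θ)
    have h := hv0
    rw [LinearMap.comp_apply, LinearEquiv.coe_toLinearMap, WithLp.coe_linearEquiv, ContinuousLinearMap.coe_coe, ContinuousLinearMap.comp_apply, hP] at h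
    exact h
  have h0 := eq_zero_of_snd_eq_zero_of_forall_inner_residue_eq_zero f φ S R hRsymm Θ x hxΘ hΘ C r w Uiso hU hrG e hpair ⟨v, hvΘ⟩ hv2 (fun c a => hperp (c, a))
  exact congrArg Subtype.val h0

/-- **H8 (IDENT), `U_b = U ∘ P_{Sc}` EDITION** (the model map precomposed with the orthogonal projection onto a complete sub-block `Sc ≤ Θ`, K2E1-p15's D2 shape `U_b = U_SD ∘ P_{Sc}`
when `Θ ⊋ Sc`; on `Sc` the two model maps agree, so atoms and conclusion are the same). [cite: MoeglinWaldspurger1995, IV.1.11, V.3.13, VI.2] -/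
theorem blockAtoms_subset_span_residues_of_letters_proj
    (f : ι → α → ℝ → ℂ) (φ : α → V) (S : Finset ℝ) (R : ℝ → V →ₗ[ℂ] V) (hRsymm : ∀ c ∈ S, ∀ v v' : V, ⟪v, R c v'⟫_ℂ = ⟪R c v, v'⟫_ℂ)
    (Θ : Submodule ℂ H) [Θ.HasOrthogonalProjection] (x : ι → H) (hxΘ : ∀ i, x i ∈ Θ) (hΘ : (Θ : Set H) ⊆ closure (Submodule.span ℂ (Set.range x) : Set H))
    (C : ℝ) (r : ι → PiLp 2 (fun _ : ↥S => V)) (w : ι → M₂) (Uiso : ↥Θ →ₗᵢ[ℂ] WithLp 2 (PiLp 2 (fun _ : ↥S => V) × M₂))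
    (hU : ∀ i, Uiso ⟨x i, hxΘ i⟩ = WithLp.toLp 2 (r i, w i))
    (hrG : ∀ i j, ⟪r i, r j⟫_ℂ = (C : ℂ) * ∑ c ∈ S, ⟪∑ b, mellin (f i b) (-(c : ℂ)) • φ b, R c (∑ a, mellin (f j a) (-(c : ℂ)) • φ a)⟫_ℂ)
    (Sc : Submodule ℂ H) [Sc.HasOrthogonalProjection] (hBD : Sc ≤ Θ)
    (e : ↥S × α → H) (he : ∀ p, e p ∈ Sc)
    (hU0 : ∀ p, ((((WithLp.linearEquiv 2 ℂ (PiLp 2 (fun _ : ↥S => V) × M₂)).toLinearMap ∘ₗ (Uiso.toContinuousLinearMap.comp Θ.orthogonalProjectionOnto).toLinearMap) ∘ₗ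
        (Sc.starProjection : H →L[ℂ] H).toLinearMap) (e p)).2 = 0)
    (hpair : ∀ (i : ι) (c : ↥S) (a : α), ⟪x i, e (c, a)⟫_ℂ = (C : ℂ) * ⟪∑ b, mellin (f i b) (-((c : ℝ) : ℂ)) • φ b, R c (φ a)⟫_ℂ) :
    ∀ v ∈ Sc, ((((WithLp.linearEquiv 2 ℂ (PiLp 2 (fun _ : ↥S => V) × M₂)).toLinearMap ∘ₗ (Uiso.toContinuousLinearMap.comp Θ.orthogonalProjectionOnto).toLinearMap) ∘ₗ
        (Sc.starProjection : H →L[ℂ] H).toLinearMap) v).2 = 0 →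
      v ∈ Submodule.span ℂ (Set.range e) := by
  -- on `Sc` the projected model map is the model map
  have hagree : ∀ u ∈ Sc, ((((WithLp.linearEquiv 2 ℂ (PiLp 2 (fun _ : ↥S => V) × M₂)).toLinearMap ∘ₗ (Uiso.toContinuousLinearMap.comp Θ.orthogonalProjectionOnto).toLinearMap) ∘ₗ
        (Sc.starProjection : H →L[ℂ] H).toLinearMap) u) =
      (((WithLp.linearEquiv 2 ℂ (PiLp 2 (fun _ : ↥S => V) × M₂)).toLinearMap ∘ₗ (Uiso.toContinuousLinearMap.comp Θ.orthogonalProjectionOnto).toLinearMap) u) := fun u hu => by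
    rw [LinearMap.comp_apply, ContinuousLinearMap.coe_coe, Submodule.starProjection_eq_self_iff.2 hu]
  intro v hv hv0
  rw [hagree v hv] at hv0
  exact blockAtoms_subset_span_residues_of_letters f φ S R hRsymm Θ x hxΘ hΘ C r w Uiso hU hrG Sc hBD e he (fun p => (hagree _ (he p)) ▸ hU0 p) hpair v hv hv0

/-- **H8 (IDENT) AT `Θ = closure span {x_i}`** — the ★ `exists_linearIsometry_selfDual_of_letters` ∕ ★ `K2E1PlancherelModelMapOfIsometry` spelling (`Uiso` on
`(span ℂ (range x)).topologicalClosure`, generators by ★ `mem_topologicalClosure_span`), for consumers keyed to that domain. [cite: MoeglinWaldspurger1995, IV.1.11, V.3.13, VI.2] -/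
theorem blockAtoms_subset_span_residues_of_letters_closureSpan [CompleteSpace H]
    (f : ι → α → ℝ → ℂ) (φ : α → V) (S : Finset ℝ) (R : ℝ → V →ₗ[ℂ] V) (hRsymm : ∀ c ∈ S, ∀ v v' : V, ⟪v, R c v'⟫_ℂ = ⟪R c v, v'⟫_ℂ)
    (x : ι → H) (C : ℝ) (r : ι → PiLp 2 (fun _ : ↥S => V)) (w : ι → M₂)
    (Uiso : ↥(Submodule.span ℂ (Set.range x)).topologicalClosure →ₗᵢ[ℂ] WithLp 2 (PiLp 2 (fun _ : ↥S => V) × M₂))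
    (hU : ∀ i, Uiso ⟨x i, mem_topologicalClosure_span x i⟩ = WithLp.toLp 2 (r i, w i))
    (hrG : ∀ i j, ⟪r i, r j⟫_ℂ = (C : ℂ) * ∑ c ∈ S, ⟪∑ b, mellin (f i b) (-(c : ℂ)) • φ b, R c (∑ a, mellin (f j a) (-(c : ℂ)) • φ a)⟫_ℂ)
    (Sc : Submodule ℂ H) (hBD : Sc ≤ (Submodule.span ℂ (Set.range x)).topologicalClosure)
    (e : ↥S × α → H) (he : ∀ p, e p ∈ Sc)
    (hU0 : haveI := completeSpace_topologicalClosure_span x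
      ∀ p, (((WithLp.linearEquiv 2 ℂ (PiLp 2 (fun _ : ↥S => V) × M₂)).toLinearMap ∘ₗ
        (Uiso.toContinuousLinearMap.comp (Submodule.span ℂ (Set.range x)).topologicalClosure.orthogonalProjectionOnto).toLinearMap) (e p)).2 = 0)
    (hpair : ∀ (i : ι) (c : ↥S) (a : α), ⟪x i, e (c, a)⟫_ℂ = (C : ℂ) * ⟪∑ b, mellin (f i b) (-((c : ℝ) : ℂ)) • φ b, R c (φ a)⟫_ℂ) :
    haveI := completeSpace_topologicalClosure_span x
    ∀ v ∈ Sc, (((WithLp.linearEquiv 2 ℂ (PiLp 2 (fun _ : ↥S => V) × M₂)).toLinearMap ∘ₗ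
        (Uiso.toContinuousLinearMap.comp (Submodule.span ℂ (Set.range x)).topologicalClosure.orthogonalProjectionOnto).toLinearMap) v).2 = 0 →
      v ∈ Submodule.span ℂ (Set.range e) := by
  haveI := completeSpace_topologicalClosure_span x
  exact blockAtoms_subset_span_residues_of_letters f φ S R hRsymm _ x (mem_topologicalClosure_span x) (by rw [Submodule.topologicalClosure_coe]) C r w Uiso hU hrG Sc hBD e he hU0 hpair

end Head

end Summit.HodgeConjecture.HodgeConjecture.R90.S8

end
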